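import Literature.NumberTheory.LFunctions.DispersionKloostermanPhases
import Literature.NumberTheory.LFunctions.DispersionFourierDecay
import Literature.NumberTheory.Sieve.BombieriFriedlanderIwaniecTheorem5Poisson
import Literature.NumberTheory.Sieve.PolynomialCongruencesWeyl
import HarnessLib

/-!
# Linnik dispersion for `u ∣ A d m + B`: Poisson summation and the dispersion of one pair of moduli

Topic `Literature/NumberTheory/Sieve` (the dispersion method; E. Bombieri, J. B. Friedlander,
H. Iwaniec, *Primes in arithmetic progressions to large moduli*, Acta Math. 156 (1986), §6
(6.9)–(6.14) and §9, with Weil's bound for the incomplete Kloosterman sums).  Third file of the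
chain `LFunctions/DispersionKloostermanPhases` (congruence structure, Kloosterman-fraction phases,
the pair sum) → `LFunctions/DispersionFourierDecay` (Fourier coefficients of the smooth weight) →
this file → `LinearDispersionEngine` (the sum over the moduli).  Written for the dispersion range
of the linear pair window of the polynomial Möbius tail (crux `PolyMobiusTail`, summit
Parity/BatemanHorn); nothing here refers to it.  Everything is PROVED; no definitions, no named
facts.

Setting: squarefree moduli `u, u'` coprime to `A Q` and to `B`, `e = (u,u')`, `u₁ = u/e`,
`v = u'/e`, `N = Q u v = Q [u,u']`; the short variables `m = c_m + Qy`, `m' = c_m + Qy'`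
(`y₁ < y, y' ≤ y₂`); the long variable `d ≡ c_d (mod Q)`, `0 ≤ d ≤ 4R`, weighted by a smooth `F`
supported in `[R/2, 4R]` with `|F| ≤ C₀`, `|F''| ≤ C₂ R⁻²`.

* `LD_norm_exp_inv` — the Kloosterman-fraction phases are unimodular (with the tree's
  `norm_exp_two_pi_mul_I`); `LD_lcm_eq`.
* **`LD_pair_poisson`** — for a compatible pair `(m, m')`,
  `∑_{d ≡ c_d (Q)} F(d) [u ∣ Adm+B] [u' ∣ Adm'+B] − 𝓕F(0)/N
   = N⁻¹ ∑_{h ≠ 0} e(c_d h (uv)‾/Q) e(−hB (AQv m)‾/u) e(−hB (AQu m')‾/v) 𝓕F(h/N)`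
  (Poisson summation over the single class modulo `N` given by `DK_congr_structure`, through the
  tree's `BFI.sum_filter_natCast_eq_tsum`).
* **`LD_pair_dispersion_le`** — the dispersion of one pair of moduli:
  `‖∑_{d ≡ c_d (Q)} F(d) (∑_y [u ∣ Adm+B]) (∑_{y'} [u' ∣ Adm'+B]) − (∫F)/(Q[u,u']) · N(u,u')‖`
  `≤ 4 √(C₀C₂) τ(u₁v) · e · (((y₂−y₁)/e+2)/u₁ + τ(u₁)√u₁(1+log u₁)) · (((y₂−y₁)/e+2)/v + τ(v)√v(1+log v))`,
  `N(u,u') = #{(y,y') : (m,u) = (m',u') = 1, m ≡ m' (e)}` (the incompatible pairs contribute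
  nothing by `DK_cond_of_dvd`; the `h`-sum is bounded by `DK_sum_fourier_gcd_le`, the sum over
  pairs by `DK_pairSum_le`).

## References

* E. Bombieri, J. B. Friedlander, H. Iwaniec, Acta Math. 156 (1986), 203–251, §6, §9.
  [BombieriFriedlanderIwaniecActa1986]
-/

noncomputable section

open Finset Real MeasureTheory
open scoped FourierTransform ContDiff ArithmeticFunction.sigma

namespace Literature.NumberTheory.Sieve

open Literature.NumberTheory.LFunctions

/-! ## The dispersion of one pair of moduli `(u, u')` -/

/-- `‖e(a x̄/s)‖ = 1` for the Kloosterman-fraction phases. [folklore] -/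
theorem LD_norm_exp_inv (s : ℕ) (a x : ℤ) :
    ‖Complex.exp (2 * Real.pi * Complex.I *
        ((a : ℂ) * (((((x : ZMod s))⁻¹).val : ℕ) : ℂ) / (s : ℂ)))‖ = 1 := by
  rw [show (2 * (Real.pi : ℂ) * Complex.I * ((a : ℂ) * (((((x : ZMod s))⁻¹).val : ℕ) : ℂ) / (s : ℂ)))
      = 2 * Real.pi * Complex.I * (((a : ℝ) * (((((x : ZMod s))⁻¹).val : ℕ) : ℝ) / (s : ℝ) : ℝ) : ℂ)
      by push_cast; ring]
  exact norm_exp_two_pi_mul_I _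

/-- **Poisson summation for one compatible pair** (BFI §6, (6.9)–(6.10)).  In the setting of
`DK_congr_structure` (squarefree `u, u'` coprime to `AQ`, `(m,u) = (m',u') = 1`,
`m ≡ m' (mod (u,u'))`), for a smooth `F` supported in `[R/2, 4R]`, `R > 0`, and `N = Q u v`,
`v = u'/(u,u')`:
`∑_{0 ≤ d ≤ 4R, d ≡ c_d (Q)} F(d) [u ∣ Adm+B] [u' ∣ Adm'+B] − 𝓕F(0)/N`
`= N⁻¹ ∑_{h ≠ 0} e(c_d h (uv)‾/Q) e(−hB (AQv m)‾/u) e(−hB (AQu m')‾/v) 𝓕F(h/N)`.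
[cite: BombieriFriedlanderIwaniecActa1986, §6 (6.9)–(6.11)] -/
theorem LD_pair_poisson {A : ℕ} {B : ℤ} {Q u u' : ℕ} (hQ : 0 < Q)
    (hu : Squarefree u) (hu' : Squarefree u') (hAu : A.Coprime u) (hAu' : A.Coprime u')
    (hQu : Q.Coprime u) (hQu' : Q.Coprime u')
    {F : ℝ → ℝ} {R : ℝ} (hR : 0 < R) (hF : ContDiff ℝ ∞ F)
    (hsupp : ∀ x, F x ≠ 0 → R / 2 ≤ x ∧ x ≤ 4 * R) (cd m m' : ℤ)
    (hm : Int.gcd m u = 1) (hm' : Int.gcd m' u' = 1) (hmm : m ≡ m' [ZMOD (Nat.gcd u u' : ℕ)]) :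
    ∑ d ∈ (Finset.range (⌊4 * R⌋₊ + 1)).filter (fun d : ℕ => (d : ℤ) ≡ cd [ZMOD Q]),
        ((F d : ℝ) : ℂ) * ((if (u : ℤ) ∣ (A : ℤ) * d * m + B then (1 : ℂ) else 0) *
          (if (u' : ℤ) ∣ (A : ℤ) * d * m' + B then (1 : ℂ) else 0)) -
      ((Q * u * (u' / Nat.gcd u u') : ℕ) : ℂ)⁻¹ * 𝓕 (fun t => (F t : ℂ)) 0 =
    ((Q * u * (u' / Nat.gcd u u') : ℕ) : ℂ)⁻¹ * ∑' h : ℤ, (if h = 0 then (0 : ℂ) else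
      Complex.exp (2 * Real.pi * Complex.I *
          ((((((cd * h : ℤ) : ZMod Q) *
              (((u * (u' / Nat.gcd u u') : ℕ) : ZMod Q))⁻¹).val : ℕ) : ℂ) / (Q : ℂ))) *
        Complex.exp (2 * Real.pi * Complex.I *
          (((-(h * B) : ℤ) : ℂ) *
            ((((((((A * Q * (u' / Nat.gcd u u') : ℕ) : ℤ) * m : ℤ) : ZMod u))⁻¹).val : ℕ) : ℂ) /
              (u : ℂ))) *
        Complex.exp (2 * Real.pi * Complex.I *
          (((-(h * B) : ℤ) : ℂ) *
            ((((((((A * Q * u : ℕ) : ℤ) * m' : ℤ) : ZMod (u' / Nat.gcd u u')))⁻¹).val : ℕ) : ℂ) /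
              ((u' / Nat.gcd u u' : ℕ) : ℂ))) *
        𝓕 (fun t => (F t : ℂ)) ((h : ℝ) / ((Q * u * (u' / Nat.gcd u u') : ℕ) : ℝ))) := by
  classical
  obtain ⟨r, hr, hphase⟩ := DK_congr_structure hQ hu hu' hAu hAu' hQu hQu' cd m m' hm hm' hmm
  obtain ⟨-, -, -, -, hv0, -, -⟩ := DK_gcd_facts hu hu'
  have hu0 : 0 < u := Nat.pos_of_ne_zero hu.ne_zero
  have hN0 : 0 < Q * u * (u' / Nat.gcd u u') := Nat.mul_pos (Nat.mul_pos hQ hu0) hv0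
  haveI : NeZero (Q * u * (u' / Nat.gcd u u')) := ⟨hN0.ne'⟩
  set Fc : ℝ → ℂ := fun t => (F t : ℂ) with hFc
  -- the `d`-sum is the sum of `F` over the class `r (mod N)`
  have hsum : ∑ d ∈ (Finset.range (⌊4 * R⌋₊ + 1)).filter (fun d : ℕ => (d : ℤ) ≡ cd [ZMOD Q]),
        ((F d : ℝ) : ℂ) * ((if (u : ℤ) ∣ (A : ℤ) * d * m + B then (1 : ℂ) else 0) *
          (if (u' : ℤ) ∣ (A : ℤ) * d * m' + B then (1 : ℂ) else 0)) =
      ∑ d ∈ (Finset.range (⌊4 * R⌋₊ + 1)).filter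
        (fun d : ℕ => (d : ZMod (Q * u * (u' / Nat.gcd u u'))) = r), Fc d := by
    rw [Finset.sum_filter, Finset.sum_filter]
    refine Finset.sum_congr rfl fun d _ => ?_
    have key := hr (d : ℤ)
    rw [Int.cast_natCast] at key
    by_cases h1 : (d : ℤ) ≡ cd [ZMOD Q] <;>
      by_cases h2 : (u : ℤ) ∣ (A : ℤ) * d * m + B <;>
        by_cases h3 : (u' : ℤ) ∣ (A : ℤ) * d * m' + B
    · rw [if_pos h1, if_pos h2, if_pos h3, if_pos (key.mp ⟨h1, h2, h3⟩), mul_one, mul_one]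
    all_goals
      have hne : ¬((d : ZMod (Q * u * (u' / Nat.gcd u u'))) = r) := fun h => by
        obtain ⟨g1, g2, g3⟩ := key.mpr h; tauto
      simp [h1, h2, h3, hne]
  -- Poisson summation
  have hFL : ∀ n : ℕ, Fc n ≠ 0 → n ≤ ⌊4 * R⌋₊ := by
    intro n hn
    have hn' : F n ≠ 0 := fun h => hn (by simp [hFc, h])
    exact Nat.le_floor (hsupp n hn').2
  have hFneg : ∀ n : ℤ, n < 0 → Fc n = 0 := by
    intro n hn
    have : F n = 0 := by
      by_contra h
      have h1 := (hsupp n h).1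
      have h2 : (n : ℝ) < 0 := by exact_mod_cast hn
      linarith
    simp [hFc, this]
  have hP := BFI.sum_filter_natCast_eq_tsum (DK_contDiff_ofReal hF) (DK_hasCompactSupport_ofReal hsupp)
    hFL hFneg hN0 r
  rw [hsum, hP, ← mul_sub]
  congr 1
  -- remove the zero frequency
  have hS : Summable (fun h : ℤ =>
      ((𝐞 ((r.val : ℝ) * h / ((Q * u * (u' / Nat.gcd u u') : ℕ) : ℝ)) : Circle) : ℂ) *
        𝓕 Fc ((h : ℝ) / ((Q * u * (u' / Nat.gcd u u') : ℕ) : ℝ))) := by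
    refine Summable.of_norm_bounded (DK_summable_fourier_div hF hsupp hN0).norm fun h => ?_
    rw [norm_mul, Circle.norm_coe, one_mul]
  rw [hS.tsum_eq_add_tsum_ite 0]
  simp only [Int.cast_zero, mul_zero, zero_div, AddChar.map_zero_eq_one, Circle.coe_one, one_mul,
    add_sub_cancel_left]
  refine tsum_congr fun h => ?_
  split_ifs with hh
  · rfl
  · rw [hphase h]

/-- `lcm(u, u') = u · (u'/(u,u'))`. [folklore] -/
theorem LD_lcm_eq (u u' : ℕ) : Nat.lcm u u' = u * (u' / Nat.gcd u u') := by
  rw [Nat.lcm, Nat.mul_div_assoc _ (Nat.gcd_dvd_right u u')]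

/-- **The dispersion of one pair of moduli.**  Let `u, u'` be squarefree, coprime to `A Q` and to
`B`, `e = (u,u')`, `u₁ = u/e`, `v = u'/e`; let `F` be smooth, supported in `[R/2, 4R]` (`R > 0`),
`|F| ≤ C₀`, `|F''| ≤ C₂R⁻²`; `m = c_m + Qy`, `m' = c_m + Qy'` with `y₁ < y, y' ≤ y₂`.  Then
`‖∑_{d ≡ c_d (Q)} F(d) (∑_y [u ∣ Adm+B]) (∑_{y'} [u' ∣ Adm'+B]) − (∫F)/(Q [u,u']) · N(u,u')‖`
`≤ 4 √(C₀C₂) τ(u₁v) · e · (((y₂−y₁)/e+2)/u₁ + τ(u₁)√u₁(1+log u₁)) · (((y₂−y₁)/e+2)/v + τ(v)√v(1+log v))`,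
`N(u,u') = #{(y,y') : (m,u) = (m',u') = 1, m ≡ m' (e)}`: expand, Poisson in `d` for each
compatible pair (`LD_pair_poisson`; the incompatible pairs contribute nothing), interchange the
`h`-sum with the sum over pairs, bound the latter by `DK_pairSum_le` (Weil) and the former by
`DK_sum_fourier_gcd_le`.  [cite: BombieriFriedlanderIwaniecActa1986, §6 (6.11)–(6.14), §9] -/
theorem LD_pair_dispersion_le {A : ℕ} {B : ℤ} {Q u u' : ℕ} (hQ : 0 < Q)
    (hu : Squarefree u) (hu' : Squarefree u') (hAu : A.Coprime u) (hAu' : A.Coprime u')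
    (hBu : Int.gcd B u = 1) (hBu' : Int.gcd B u' = 1) (hQu : Q.Coprime u) (hQu' : Q.Coprime u')
    {F : ℝ → ℝ} {R C₀ C₂ : ℝ} (hR : 0 < R) (hF : ContDiff ℝ ∞ F)
    (hsupp : ∀ x, F x ≠ 0 → R / 2 ≤ x ∧ x ≤ 4 * R) (hC₀ : ∀ x, ‖F x‖ ≤ C₀)
    (hC₂ : ∀ x, ‖iteratedDeriv 2 F x‖ ≤ C₂ / R ^ 2) (cd cm y₁ y₂ : ℤ) (hy : y₁ ≤ y₂) :
    ‖(∑ d ∈ (Finset.range (⌊4 * R⌋₊ + 1)).filter (fun d : ℕ => (d : ℤ) ≡ cd [ZMOD Q]),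
        ((F d : ℝ) : ℂ) *
          ((∑ y ∈ Finset.Ioc y₁ y₂,
              (if (u : ℤ) ∣ (A : ℤ) * d * (cm + Q * y) + B then (1 : ℂ) else 0)) *
            (∑ y ∈ Finset.Ioc y₁ y₂,
              (if (u' : ℤ) ∣ (A : ℤ) * d * (cm + Q * y) + B then (1 : ℂ) else 0)))) -
      ((∫ x, F x : ℝ) : ℂ) / (Q : ℂ) *
        ((((Finset.Ioc y₁ y₂) ×ˢ (Finset.Ioc y₁ y₂)).filter (fun p : ℤ × ℤ =>
            Int.gcd (cm + Q * p.1) u = 1 ∧ Int.gcd (cm + Q * p.2) u' = 1 ∧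
              cm + Q * p.1 ≡ cm + Q * p.2 [ZMOD (Nat.gcd u u' : ℕ)])).card : ℂ) /
          ((Nat.lcm u u' : ℕ) : ℂ)‖ ≤
      4 * Real.sqrt (C₀ * C₂) *
        ((Nat.divisors ((u / Nat.gcd u u') * (u' / Nat.gcd u u'))).card : ℝ) *
        ((Nat.gcd u u' : ℝ) *
          ((((y₂ - y₁ : ℤ) : ℝ) / (Nat.gcd u u' : ℕ) + 2) / ((u / Nat.gcd u u' : ℕ) : ℝ) +
            (Nat.divisors (u / Nat.gcd u u')).card * Real.sqrt ((u / Nat.gcd u u' : ℕ) : ℝ) *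
              (1 + Real.log ((u / Nat.gcd u u' : ℕ) : ℝ))) *
          ((((y₂ - y₁ : ℤ) : ℝ) / (Nat.gcd u u' : ℕ) + 2) / ((u' / Nat.gcd u u' : ℕ) : ℝ) +
            (Nat.divisors (u' / Nat.gcd u u')).card * Real.sqrt ((u' / Nat.gcd u u' : ℕ) : ℝ) *
              (1 + Real.log ((u' / Nat.gcd u u' : ℕ) : ℝ)))) := by
  obtain ⟨-, -, -, he0, hv0, -, -⟩ := DK_gcd_facts hu hu'
  have hu0 : 0 < u := Nat.pos_of_ne_zero hu.ne_zero
  have hu₁0 : 0 < u / Nat.gcd u u' :=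
    Nat.div_pos (Nat.le_of_dvd hu0 (Nat.gcd_dvd_left u u')) he0
  have hn0 : 0 < (u / Nat.gcd u u') * (u' / Nat.gcd u u') := Nat.mul_pos hu₁0 hv0
  have hN0 : 0 < Q * u * (u' / Nat.gcd u u') := Nat.mul_pos (Nat.mul_pos hQ hu0) hv0
  have hN0' : (0 : ℝ) < ((Q * u * (u' / Nat.gcd u u') : ℕ) : ℝ) := by exact_mod_cast hN0
  haveI : NeZero (Q * u * (u' / Nat.gcd u u')) := ⟨hN0.ne'⟩
  -- notation
  set Fc : ℝ → ℂ := fun t => (F t : ℂ) with hFc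
  set Nr : ℝ := ((Q * u * (u' / Nat.gcd u u') : ℕ) : ℝ) with hNr
  set ι₁ : ℕ → ℤ → ℂ := fun d y =>
    if (u : ℤ) ∣ (A : ℤ) * d * (cm + Q * y) + B then (1 : ℂ) else 0 with hι₁
  set ι₂ : ℕ → ℤ → ℂ := fun d y =>
    if (u' : ℤ) ∣ (A : ℤ) * d * (cm + Q * y) + B then (1 : ℂ) else 0 with hι₂
  set θ : ℤ → ℂ := fun h => Complex.exp (2 * Real.pi * Complex.I *
      ((((((cd * h : ℤ) : ZMod Q) *
        (((u * (u' / Nat.gcd u u') : ℕ) : ZMod Q))⁻¹).val : ℕ) : ℂ) / (Q : ℂ))) with hθ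
  set Φ : ℤ × ℤ → ℤ → ℂ := fun p h =>
    Complex.exp (2 * Real.pi * Complex.I *
      (((-(h * B) : ℤ) : ℂ) *
        (((((((A * Q * (u' / Nat.gcd u u') : ℕ) : ℤ) * (cm + Q * p.1) : ℤ) :
          ZMod u)⁻¹).val : ℕ) : ℂ) / (u : ℂ))) *
    Complex.exp (2 * Real.pi * Complex.I *
      (((-(h * B) : ℤ) : ℂ) *
        (((((((A * Q * u : ℕ) : ℤ) * (cm + Q * p.2) : ℤ) :
          ZMod (u' / Nat.gcd u u'))⁻¹).val : ℕ) : ℂ) / ((u' / Nat.gcd u u' : ℕ) : ℂ))) with hΦ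
  set 𝓕h : ℤ → ℂ := fun h => 𝓕 Fc ((h : ℝ) / Nr) with h𝓕h
  set P : Finset (ℤ × ℤ) := (Finset.Ioc y₁ y₂) ×ˢ (Finset.Ioc y₁ y₂) with hP
  set Pc : Finset (ℤ × ℤ) := P.filter (fun p : ℤ × ℤ =>
    Int.gcd (cm + Q * p.1) u = 1 ∧ Int.gcd (cm + Q * p.2) u' = 1 ∧
      cm + Q * p.1 ≡ cm + Q * p.2 [ZMOD (Nat.gcd u u' : ℕ)]) with hPc
  set X : ℤ → ℂ := fun h => if h = 0 then 0 else θ h * 𝓕h h * ∑ p ∈ Pc, Φ p h with hX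
  set B₁ : ℝ := (((y₂ - y₁ : ℤ) : ℝ) / (Nat.gcd u u' : ℕ) + 2) / ((u / Nat.gcd u u' : ℕ) : ℝ) +
    (Nat.divisors (u / Nat.gcd u u')).card * Real.sqrt ((u / Nat.gcd u u' : ℕ) : ℝ) *
      (1 + Real.log ((u / Nat.gcd u u' : ℕ) : ℝ)) with hB₁
  set B₂ : ℝ := (((y₂ - y₁ : ℤ) : ℝ) / (Nat.gcd u u' : ℕ) + 2) / ((u' / Nat.gcd u u' : ℕ) : ℝ) +
    (Nat.divisors (u' / Nat.gcd u u')).card * Real.sqrt ((u' / Nat.gcd u u' : ℕ) : ℝ) *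
      (1 + Real.log ((u' / Nat.gcd u u' : ℕ) : ℝ)) with hB₂
  -- nonnegativity of the bounds
  have hy0 : (0 : ℝ) ≤ ((y₂ - y₁ : ℤ) : ℝ) := by exact_mod_cast (sub_nonneg.mpr hy)
  have hnum : 0 ≤ ((y₂ - y₁ : ℤ) : ℝ) / (Nat.gcd u u' : ℕ) + 2 := by
    have := div_nonneg hy0 (Nat.cast_nonneg (Nat.gcd u u')); linarith
  have hlog₁ : 0 ≤ 1 + Real.log ((u / Nat.gcd u u' : ℕ) : ℝ) := by
    have := Real.log_nonneg (show (1 : ℝ) ≤ ((u / Nat.gcd u u' : ℕ) : ℝ) by exact_mod_cast hu₁0)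
    linarith
  have hlog₂ : 0 ≤ 1 + Real.log ((u' / Nat.gcd u u' : ℕ) : ℝ) := by
    have := Real.log_nonneg (show (1 : ℝ) ≤ ((u' / Nat.gcd u u' : ℕ) : ℝ) by exact_mod_cast hv0)
    linarith
  have hB₁0 : 0 ≤ B₁ := by
    rw [hB₁]
    exact add_nonneg (div_nonneg hnum (Nat.cast_nonneg _))
      (mul_nonneg (mul_nonneg (Nat.cast_nonneg _) (Real.sqrt_nonneg _)) hlog₁)
  have hB₂0 : 0 ≤ B₂ := by
    rw [hB₂]
    exact add_nonneg (div_nonneg hnum (Nat.cast_nonneg _))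
      (mul_nonneg (mul_nonneg (Nat.cast_nonneg _) (Real.sqrt_nonneg _)) hlog₂)
  have heBB : 0 ≤ (Nat.gcd u u' : ℝ) * B₁ * B₂ :=
    mul_nonneg (mul_nonneg (Nat.cast_nonneg _) hB₁0) hB₂0
  -- unimodularity and summability
  have hθ1 : ∀ h, ‖θ h‖ = 1 := by
    intro h
    rw [hθ]
    dsimp only
    rw [show (2 * (Real.pi : ℂ) * Complex.I * (((((((cd * h : ℤ) : ZMod Q) *
        (((u * (u' / Nat.gcd u u') : ℕ) : ZMod Q))⁻¹).val : ℕ) : ℂ) / (Q : ℂ)))) =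
        2 * Real.pi * Complex.I * (((((((cd * h : ℤ) : ZMod Q) *
        (((u * (u' / Nat.gcd u u') : ℕ) : ZMod Q))⁻¹).val : ℕ) : ℝ) / (Q : ℝ) : ℝ) : ℂ) by
      push_cast; ring]
    exact norm_exp_two_pi_mul_I _
  have hΦ1 : ∀ p h, ‖Φ p h‖ = 1 := by
    intro p h
    rw [hΦ]
    dsimp only
    rw [norm_mul, LD_norm_exp_inv, LD_norm_exp_inv, one_mul]
  have hsumm : Summable 𝓕h := DK_summable_fourier_div hF hsupp hN0
  have hXb : ∀ h, ‖X h‖ ≤ (Pc.card : ℝ) * ‖𝓕h h‖ := by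
    intro h
    rw [hX]
    dsimp only
    split_ifs
    · rw [norm_zero]; positivity
    · rw [norm_mul, norm_mul, hθ1, one_mul, mul_comm]
      refine mul_le_mul_of_nonneg_right ((norm_sum_le _ _).trans ?_) (norm_nonneg _)
      rw [Finset.sum_congr rfl (fun p _ => hΦ1 p h), Finset.sum_const, nsmul_eq_mul, mul_one]
  have hXs : Summable (fun h => ‖X h‖) :=
    (Summable.of_norm_bounded (hsumm.norm.mul_left _) hXb).norm
  -- Step 1: each pair
  have hPo : ∀ p ∈ Pc, ∑ d ∈ (Finset.range (⌊4 * R⌋₊ + 1)).filter (fun d : ℕ => (d : ℤ) ≡ cd [ZMOD Q]),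
        ((F d : ℝ) : ℂ) * (ι₁ d p.1 * ι₂ d p.2) - (Nr : ℂ)⁻¹ * 𝓕 Fc 0 =
      (Nr : ℂ)⁻¹ * ∑' h : ℤ, (if h = 0 then (0 : ℂ) else θ h * Φ p h * 𝓕h h) := by
    intro p hp
    rw [hPc, Finset.mem_filter] at hp
    obtain ⟨-, hc⟩ := hp
    have key := LD_pair_poisson (B := B) hQ hu hu' hAu hAu' hQu hQu' hR hF hsupp cd (cm + Q * p.1)
      (cm + Q * p.2) hc.1 hc.2.1 hc.2.2
    rw [hNr, Complex.ofReal_natCast, key]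
    congr 1
    refine tsum_congr fun h => ?_
    split_ifs
    · rfl
    · simp only [hθ, hΦ, h𝓕h, hFc, hNr]
      ring
  have hzero : ∀ p ∈ P.filter (fun p : ℤ × ℤ => ¬(Int.gcd (cm + Q * p.1) u = 1 ∧
      Int.gcd (cm + Q * p.2) u' = 1 ∧ cm + Q * p.1 ≡ cm + Q * p.2 [ZMOD (Nat.gcd u u' : ℕ)])),
      ∑ d ∈ (Finset.range (⌊4 * R⌋₊ + 1)).filter (fun d : ℕ => (d : ℤ) ≡ cd [ZMOD Q]),
        ((F d : ℝ) : ℂ) * (ι₁ d p.1 * ι₂ d p.2) = 0 := by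
    intro p hp
    rw [Finset.mem_filter] at hp
    obtain ⟨-, hc⟩ := hp
    refine Finset.sum_eq_zero fun d _ => ?_
    simp only [hι₁, hι₂]
    by_cases h2 : (u : ℤ) ∣ (A : ℤ) * d * (cm + Q * p.1) + B
    · by_cases h3 : (u' : ℤ) ∣ (A : ℤ) * d * (cm + Q * p.2) + B
      · exact absurd (DK_cond_of_dvd hBu hBu' h2 h3) hc
      · simp [h3]
    · simp [h2]
  have hX_eq : ∀ h : ℤ, ∑ p ∈ Pc, (if h = 0 then (0 : ℂ) else θ h * Φ p h * 𝓕h h) = X h := by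
    intro h
    simp only [hX]
    split_ifs
    · exact Finset.sum_const_zero
    · rw [Finset.mul_sum]
      exact Finset.sum_congr rfl fun p _ => by ring
  have hsp : ∀ p ∈ Pc, Summable (fun h : ℤ => if h = 0 then (0 : ℂ) else θ h * Φ p h * 𝓕h h) := by
    intro p _
    refine Summable.of_norm_bounded hsumm.norm fun h => ?_
    split_ifs
    · simp
    · rw [norm_mul, norm_mul, hθ1, hΦ1, one_mul, one_mul]
  -- Step 2: the identity `T − M = N⁻¹ ∑' X`
  have hTM : (∑ d ∈ (Finset.range (⌊4 * R⌋₊ + 1)).filter (fun d : ℕ => (d : ℤ) ≡ cd [ZMOD Q]),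
        ((F d : ℝ) : ℂ) * ((∑ y ∈ Finset.Ioc y₁ y₂, ι₁ d y) * (∑ y ∈ Finset.Ioc y₁ y₂, ι₂ d y))) -
      ((∫ x, F x : ℝ) : ℂ) / (Q : ℂ) * (Pc.card : ℂ) / ((Nat.lcm u u' : ℕ) : ℂ) =
      (Nr : ℂ)⁻¹ * ∑' h : ℤ, X h := by
    have hT : ∑ d ∈ (Finset.range (⌊4 * R⌋₊ + 1)).filter (fun d : ℕ => (d : ℤ) ≡ cd [ZMOD Q]),
        ((F d : ℝ) : ℂ) * ((∑ y ∈ Finset.Ioc y₁ y₂, ι₁ d y) * (∑ y ∈ Finset.Ioc y₁ y₂, ι₂ d y)) =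
        ∑ p ∈ Pc, ∑ d ∈ (Finset.range (⌊4 * R⌋₊ + 1)).filter (fun d : ℕ => (d : ℤ) ≡ cd [ZMOD Q]),
          ((F d : ℝ) : ℂ) * (ι₁ d p.1 * ι₂ d p.2) := by
      have h1 : ∑ d ∈ (Finset.range (⌊4 * R⌋₊ + 1)).filter (fun d : ℕ => (d : ℤ) ≡ cd [ZMOD Q]),
          ((F d : ℝ) : ℂ) * ((∑ y ∈ Finset.Ioc y₁ y₂, ι₁ d y) * (∑ y ∈ Finset.Ioc y₁ y₂, ι₂ d y)) =
          ∑ p ∈ P, ∑ d ∈ (Finset.range (⌊4 * R⌋₊ + 1)).filter (fun d : ℕ => (d : ℤ) ≡ cd [ZMOD Q]),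
            ((F d : ℝ) : ℂ) * (ι₁ d p.1 * ι₂ d p.2) := by
        rw [Finset.sum_comm]
        refine Finset.sum_congr rfl fun d _ => ?_
        rw [Finset.sum_mul_sum, ← Finset.sum_product', ← Finset.mul_sum]
      rw [h1, ← Finset.sum_filter_add_sum_filter_not P (fun p : ℤ × ℤ =>
        Int.gcd (cm + Q * p.1) u = 1 ∧ Int.gcd (cm + Q * p.2) u' = 1 ∧
          cm + Q * p.1 ≡ cm + Q * p.2 [ZMOD (Nat.gcd u u' : ℕ)]), Finset.sum_eq_zero hzero, add_zero]
    have hM : ((∫ x, F x : ℝ) : ℂ) / (Q : ℂ) * (Pc.card : ℂ) / ((Nat.lcm u u' : ℕ) : ℂ) =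
        ∑ p ∈ Pc, (Nr : ℂ)⁻¹ * 𝓕 Fc 0 := by
      rw [Finset.sum_const, nsmul_eq_mul, hFc, DK_fourier_zero_eq, LD_lcm_eq, hNr]
      have hQ0 : (Q : ℂ) ≠ 0 := by exact_mod_cast hQ.ne'
      have huv0 : ((u * (u' / Nat.gcd u u') : ℕ) : ℂ) ≠ 0 := by
        exact_mod_cast (Nat.mul_pos hu0 hv0).ne'
      push_cast at huv0 ⊢
      field_simp
    rw [hT, hM, ← Finset.sum_sub_distrib, Finset.sum_congr rfl hPo, ← Finset.mul_sum,
      ← Summable.tsum_finsetSum hsp]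
    congr 1
    exact tsum_congr hX_eq
  -- Step 3: the bound
  show ‖(∑ d ∈ (Finset.range (⌊4 * R⌋₊ + 1)).filter (fun d : ℕ => (d : ℤ) ≡ cd [ZMOD Q]),
        ((F d : ℝ) : ℂ) * ((∑ y ∈ Finset.Ioc y₁ y₂, ι₁ d y) * (∑ y ∈ Finset.Ioc y₁ y₂, ι₂ d y))) -
      ((∫ x, F x : ℝ) : ℂ) / (Q : ℂ) * (Pc.card : ℂ) / ((Nat.lcm u u' : ℕ) : ℂ)‖ ≤
      4 * Real.sqrt (C₀ * C₂) *
        ((Nat.divisors ((u / Nat.gcd u u') * (u' / Nat.gcd u u'))).card : ℝ) *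
        ((Nat.gcd u u' : ℝ) * B₁ * B₂)
  rw [hTM, norm_mul, norm_inv, Complex.norm_real, Real.norm_of_nonneg hN0'.le]
  have hK : ∀ h : ℤ, ‖∑ p ∈ Pc, Φ p h‖ ≤ (Nat.gcd u u' : ℝ) *
      (Int.gcd h ((u / Nat.gcd u u') * (u' / Nat.gcd u u') : ℕ) : ℕ) * B₁ * B₂ :=
    fun h => DK_pairSum_le hu hu' hAu hAu' hBu hBu' hQu hQu' cm h y₁ y₂ hy
  calc Nr⁻¹ * ‖∑' h : ℤ, X h‖ ≤ Nr⁻¹ * ∑' h : ℤ, ‖X h‖ :=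
        mul_le_mul_of_nonneg_left (norm_tsum_le_tsum_norm hXs) (inv_nonneg.mpr hN0'.le)
    _ = ∑' h : ℤ, Nr⁻¹ * ‖X h‖ := tsum_mul_left.symm
    _ ≤ 4 * Real.sqrt (C₀ * C₂) *
        ((Nat.divisors ((u / Nat.gcd u u') * (u' / Nat.gcd u u'))).card : ℝ) *
        ((Nat.gcd u u' : ℝ) * B₁ * B₂) := by
      refine Real.tsum_le_of_sum_le (fun h => mul_nonneg (inv_nonneg.mpr hN0'.le) (norm_nonneg _))
        fun S => ?_
      calc ∑ h ∈ S, Nr⁻¹ * ‖X h‖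
          ≤ ∑ h ∈ S, (if h = 0 then (0 : ℝ) else
              ‖𝓕 (fun t => (F t : ℂ)) ((h : ℝ) / ((Q * u * (u' / Nat.gcd u u') : ℕ) : ℝ))‖ /
                ((Q * u * (u' / Nat.gcd u u') : ℕ) : ℝ) *
                (Int.gcd h ((u / Nat.gcd u u') * (u' / Nat.gcd u u') : ℕ) : ℝ)) *
              ((Nat.gcd u u' : ℝ) * B₁ * B₂) := by
            refine Finset.sum_le_sum fun h _ => ?_
            rw [hX]
            dsimp only
            split_ifs with hh
            · simp
            · rw [norm_mul, norm_mul, hθ1, one_mul]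
              calc Nr⁻¹ * (‖𝓕h h‖ * ‖∑ p ∈ Pc, Φ p h‖)
                  ≤ Nr⁻¹ * (‖𝓕h h‖ * ((Nat.gcd u u' : ℝ) *
                      (Int.gcd h ((u / Nat.gcd u u') * (u' / Nat.gcd u u') : ℕ) : ℕ) * B₁ * B₂)) := by
                    gcongr
                    exact hK h
                _ = _ := by rw [h𝓕h, hNr]; ring
        _ = (∑ h ∈ S, (if h = 0 then (0 : ℝ) else
              ‖𝓕 (fun t => (F t : ℂ)) ((h : ℝ) / ((Q * u * (u' / Nat.gcd u u') : ℕ) : ℝ))‖ /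
                ((Q * u * (u' / Nat.gcd u u') : ℕ) : ℝ) *
                (Int.gcd h ((u / Nat.gcd u u') * (u' / Nat.gcd u u') : ℕ) : ℝ))) *
              ((Nat.gcd u u' : ℝ) * B₁ * B₂) := by rw [Finset.sum_mul]
        _ ≤ (4 * Real.sqrt (C₀ * C₂) * (σ 0 ((u / Nat.gcd u u') * (u' / Nat.gcd u u')) : ℝ)) *
              ((Nat.gcd u u' : ℝ) * B₁ * B₂) :=
            mul_le_mul_of_nonneg_right (DK_sum_fourier_gcd_le hR hF hsupp hC₀ hC₂ hN0 hn0 S) heBB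
        _ = _ := by rw [ArithmeticFunction.sigma_zero_apply]

end Literature.NumberTheory.Sieve

end
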